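import Summits.Schanuel.Schanuel.Theorems.ZilberEacExpExpRootLemmas
import HarnessLib

/-!
# The exponential–exponential balance over graph bases of every degree: the root and the
# local coordinate

Zilber's Exponential-Algebraic Closedness, case ladder (host summit Schanuel, cell `pub-schanuel`,
seat 2, gen 8).  For `ZilberEacExpExpBalanceGeneral` (`e^{z} = A(z) + e^{p(z)}F(e^{p(z)})`, `deg p = D ≥ 3`):

* `exists_root_balance` — for `‖(V/(e lc p))^{1/D}‖ = r` large, `e p(z) - z = V` has a root with
  `Re z ≥ r/4`, `3r/4 ≤ ‖z‖ ≤ 5r/4` (principal `D`-th root + `exists_root_near`);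
* `exists_derivative_lower_bound` — `‖1 - e p'(z)‖ ≥ (eD|lc p|/4)‖z‖^{D-1} ≥ 1` for `‖z‖ ≥ R₁`;
* `exists_linearisation_bound` — in the local coordinate `z = z₀ + λt`, `λ = 1/(1 - e p'(z₀))`,
  the error `e(p(z₀+λt) - p(z₀) - p'(z₀)λt)` is `≤ K/‖z₀‖` on `‖t‖ ≤ 1`.

HONEST FRAMING: auxiliary analysis; nothing here bears on Schanuel's conjecture; EAC ⇏ SC.
-/

noncomputable section

open Complex Filter Topology Metric
open Literature.ModelTheory.Zilber

set_option linter.dupNamespace false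

namespace Summit.Schanuel.Schanuel.Theorems

/-- **A root of `e p(z) - z = V` pointing to the right.**  For `deg p = D ≥ 3`, `e ≥ 1` there is
`R₀` such that for every `V` with `r := ‖(V/(e lc p))^{1/D}‖ ≥ R₀` the equation `e p(z) - z - V = 0`
has a root `z` with `Re z ≥ r/4`, `3r/4 ≤ ‖z‖ ≤ 5r/4` (a root within `r/4` of the principal `D`-th
root `w`, by `exists_root_near`: `e p(w) - w - V = e p̃(w) - w = O(r^{D-1})`). [folklore] -/
theorem exists_root_balance (p : Polynomial ℂ) (hD : 3 ≤ p.natDegree) {e : ℕ} (he : 0 < e) :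
    ∃ R₀ : ℝ, ∀ V : ℂ,
      R₀ ≤ ‖(V / (e * p.leadingCoeff)) ^ ((p.natDegree : ℂ)⁻¹)‖ →
      ∃ z : ℂ, (e : ℂ) * p.eval z - z - V = 0 ∧
        ‖(V / (e * p.leadingCoeff)) ^ ((p.natDegree : ℂ)⁻¹)‖ / 4 ≤ z.re ∧
        ‖z‖ ≤ 5 / 4 * ‖(V / (e * p.leadingCoeff)) ^ ((p.natDegree : ℂ)⁻¹)‖ ∧
        3 / 4 * ‖(V / (e * p.leadingCoeff)) ^ ((p.natDegree : ℂ)⁻¹)‖ ≤ ‖z‖ := by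
  set D : ℕ := p.natDegree with hDdef
  set α : ℂ := p.leadingCoeff with hα
  have hp0 : p ≠ 0 := by rintro rfl; simp [hDdef] at hD
  have hα0 : α ≠ 0 := Polynomial.leadingCoeff_ne_zero.2 hp0
  have hαpos : 0 < ‖α‖ := norm_pos_iff.2 hα0
  have he0 : (e : ℂ) ≠ 0 := by exact_mod_cast he.ne'
  have hepos : (0 : ℝ) < e := by exact_mod_cast he
  have hD0 : D ≠ 0 := by omega
  set B' : ℝ := coeffNormSum p.eraseLead with hB'
  have hB'0 : 0 ≤ B' := coeffNormSum_nonneg _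
  refine ⟨max 1 (4 ^ D * (e * B' + 1) / (e * ‖α‖) + 1), fun V hr => ?_⟩
  set w : ℂ := (V / (e * α)) ^ ((D : ℂ)⁻¹) with hw
  set r : ℝ := ‖w‖ with hrdef
  have hr1 : 1 ≤ r := le_of_max_le_left hr
  have hr0 : 0 < r := by linarith
  have hrbig : 4 ^ D * (e * B' + 1) < e * ‖α‖ * r := by
    have h := le_of_max_le_right hr
    rw [div_add_one (by positivity), div_le_iff₀ (by positivity)] at h
    nlinarith
  have hwD : (e : ℂ) * α * w ^ D = V := by
    rw [hw, Complex.cpow_nat_inv_pow _ hD0]; field_simp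
  -- the polynomial `Q = e p - X - V`
  set Q : Polynomial ℂ := Polynomial.C (e : ℂ) * p - (Polynomial.X + Polynomial.C V) with hQ
  have hQeval : ∀ z, Q.eval z = (e : ℂ) * p.eval z - z - V := by
    intro z; simp only [hQ, Polynomial.eval_sub, Polynomial.eval_mul, Polynomial.eval_C,
      Polynomial.eval_add, Polynomial.eval_X]; ring
  have hdeg1 : (Polynomial.C (e : ℂ) * p).degree = (D : WithBot ℕ) := by
    rw [Polynomial.degree_C_mul he0, Polynomial.degree_eq_natDegree hp0]
  have hdeglt : (Polynomial.X + Polynomial.C V).degree < (Polynomial.C (e : ℂ) * p).degree := by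
    rw [hdeg1, Polynomial.degree_X_add_C]; exact_mod_cast (by omega : 1 < D)
  have hQlc : Q.leadingCoeff = e * α := by
    rw [hQ, Polynomial.leadingCoeff_sub_of_degree_lt hdeglt, Polynomial.leadingCoeff_mul,
      Polynomial.leadingCoeff_C]
  have hQdeg : Q.natDegree = D := by
    rw [hQ, Polynomial.natDegree_eq_of_degree_eq (Polynomial.degree_sub_eq_left_of_degree_lt hdeglt),
      Polynomial.natDegree_C_mul he0]
  -- `Q(w) = e p̃(w) - w`
  have hQw : Q.eval w = (e : ℂ) * p.eraseLead.eval w - w := by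
    rw [hQeval, ← Polynomial.self_sub_monomial_natDegree_leadingCoeff, Polynomial.eval_sub,
      Polynomial.eval_monomial, ← hwD]
    ring
  have hQw_le : ‖Q.eval w‖ ≤ (e * B' + 1) * r ^ (D - 1) := by
    rw [hQw]
    have h1 : ‖p.eraseLead.eval w‖ ≤ B' * r ^ (D - 1) :=
      norm_eval_le_of_natDegree_le _ hr1 le_rfl (Polynomial.eraseLead_natDegree_le p)
    have h2 : r ≤ r ^ (D - 1) := le_self_pow₀ hr1 (by omega)
    calc ‖(e : ℂ) * p.eraseLead.eval w - w‖ ≤ ‖(e : ℂ) * p.eraseLead.eval w‖ + ‖w‖ := norm_sub_le _ _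
      _ ≤ e * (B' * r ^ (D - 1)) + r ^ (D - 1) := by
          rw [norm_mul, Complex.norm_natCast]; gcongr
      _ = (e * B' + 1) * r ^ (D - 1) := by ring
  have hQw_lt : ‖Q.eval w‖ < ‖Q.leadingCoeff‖ * (r / 4) ^ Q.natDegree := by
    rw [hQlc, hQdeg, norm_mul, Complex.norm_natCast, div_pow]
    refine hQw_le.trans_lt ?_
    have hrD : r ^ D = r * r ^ (D - 1) := by
      rw [← pow_succ']; congr 1; omega
    rw [hrD]
    have h4 : (0 : ℝ) < 4 ^ D := by positivity
    have hpos : 0 < r ^ (D - 1) := by positivity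
    have h5 : (e * B' + 1) < e * ‖α‖ * r / 4 ^ D := by rw [lt_div_iff₀ h4]; linarith
    calc (e * B' + 1) * r ^ (D - 1) < (e * ‖α‖ * r / 4 ^ D) * r ^ (D - 1) :=
          mul_lt_mul_of_pos_right h5 hpos
      _ = e * ‖α‖ * (r * r ^ (D - 1) / 4 ^ D) := by ring
  obtain ⟨z, hz, hzw⟩ := exists_root_near Q w (by positivity : 0 < r / 4) hQw_lt
  refine ⟨z, by rwa [hQeval] at hz, ?_, ?_, ?_⟩
  · have hre : ‖w‖ / 2 ≤ w.re := half_norm_le_re_cpow_inv hD _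
    have h := Complex.abs_re_le_norm (z - w)
    rw [Complex.sub_re, abs_le] at h
    linarith [h.1]
  · calc ‖z‖ = ‖w + (z - w)‖ := by ring_nf
      _ ≤ ‖w‖ + ‖z - w‖ := norm_add_le _ _
      _ ≤ 5 / 4 * ‖w‖ := by linarith [hzw.le]
  · have := norm_sub_norm_le w z
    rw [norm_sub_rev] at hzw
    have h2 : ‖w‖ - ‖z‖ ≤ ‖w - z‖ := norm_sub_norm_le w z
    linarith

/-- **The derivative is large along the root**: for `deg p = D ≥ 2` (`≥ 3` assumed), `e ≥ 1` there
is `R₁ ≥ 1` with `‖1 - e p'(z)‖ ≥ (e D |lc p| / 4) ‖z‖^{D-1} ≥ 1` for `‖z‖ ≥ R₁`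
(`p' = D lc(p) X^{D-1} + q`, `deg q ≤ D - 2`). [folklore] -/
theorem exists_derivative_lower_bound (p : Polynomial ℂ) (hD : 3 ≤ p.natDegree) {e : ℕ}
    (he : 0 < e) :
    ∃ R₁ : ℝ, 1 ≤ R₁ ∧ ∀ z : ℂ, R₁ ≤ ‖z‖ →
      (e * p.natDegree * ‖p.leadingCoeff‖ / 4) * ‖z‖ ^ (p.natDegree - 1) ≤
          ‖1 - (e : ℂ) * p.derivative.eval z‖ ∧
        1 ≤ (e * p.natDegree * ‖p.leadingCoeff‖ / 4) * ‖z‖ ^ (p.natDegree - 1) := by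
  set D : ℕ := p.natDegree with hDdef
  set α : ℂ := p.leadingCoeff with hα
  have hp0 : p ≠ 0 := by rintro rfl; simp [hDdef] at hD
  have hα0 : α ≠ 0 := Polynomial.leadingCoeff_ne_zero.2 hp0
  have hαpos : 0 < ‖α‖ := norm_pos_iff.2 hα0
  have hepos : (0 : ℝ) < e := by exact_mod_cast he
  have hDpos : (0 : ℝ) < D := by exact_mod_cast (show 0 < D by omega)
  -- `q = p' - D α X^{D-1}` has degree `≤ D - 2`
  set q : Polynomial ℂ := p.derivative - Polynomial.C ((D : ℂ) * α) * Polynomial.X ^ (D - 1) with hq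
  have hqdeg : q.natDegree ≤ D - 2 := by
    rw [Polynomial.natDegree_le_iff_coeff_eq_zero]
    intro N hN
    rw [hq, Polynomial.coeff_sub, Polynomial.coeff_C_mul, Polynomial.coeff_X_pow,
      Polynomial.coeff_derivative]
    by_cases hN1 : N = D - 1
    · rw [if_pos hN1, hN1, show D - 1 + 1 = D by omega, hα, Polynomial.leadingCoeff, ← hDdef]
      push_cast [show 1 ≤ D by omega]
      ring
    · rw [if_neg hN1, mul_zero, sub_zero, Polynomial.coeff_eq_zero_of_natDegree_lt (by omega),
        zero_mul]
  set Bq : ℝ := coeffNormSum q with hBq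
  have hBq0 : 0 ≤ Bq := coeffNormSum_nonneg _
  refine ⟨max 1 (max (2 * Bq / (D * ‖α‖)) (4 / (e * D * ‖α‖))), le_max_left _ _, fun z hz => ?_⟩
  have hz1 : 1 ≤ ‖z‖ := le_of_max_le_left hz
  have hz2 : 2 * Bq / (D * ‖α‖) ≤ ‖z‖ := le_of_max_le_left (le_of_max_le_right hz)
  have hz3 : 4 / (e * D * ‖α‖) ≤ ‖z‖ := le_of_max_le_right (le_of_max_le_right hz)
  have hzpow1 : ‖z‖ ≤ ‖z‖ ^ (D - 1) := le_self_pow₀ hz1 (by omega)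
  have hderiv : p.derivative.eval z = (D : ℂ) * α * z ^ (D - 1) + q.eval z := by
    simp only [hq, Polynomial.eval_sub, Polynomial.eval_mul, Polynomial.eval_C, Polynomial.eval_pow,
      Polynomial.eval_X]; ring
  have hqz : ‖q.eval z‖ ≤ Bq * ‖z‖ ^ (D - 2) := norm_eval_le_of_natDegree_le q hz1 le_rfl hqdeg
  -- `‖p'(z)‖ ≥ (D |α| / 2) ‖z‖^{D-1}`
  have hmain : D * ‖α‖ / 2 * ‖z‖ ^ (D - 1) ≤ ‖p.derivative.eval z‖ := by
    rw [hderiv]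
    have h1 : ‖(D : ℂ) * α * z ^ (D - 1)‖ = D * ‖α‖ * ‖z‖ ^ (D - 1) := by
      rw [norm_mul, norm_mul, Complex.norm_natCast, norm_pow]
    have h2 : ‖(D : ℂ) * α * z ^ (D - 1)‖ - ‖q.eval z‖ ≤ ‖(D : ℂ) * α * z ^ (D - 1) + q.eval z‖ := by
      have := norm_sub_norm_le ((D : ℂ) * α * z ^ (D - 1)) (-(q.eval z))
      rw [norm_neg, sub_neg_eq_add] at this
      exact this
    have h3 : Bq * ‖z‖ ^ (D - 2) ≤ D * ‖α‖ / 2 * ‖z‖ ^ (D - 1) := by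
      have hpw : ‖z‖ ^ (D - 1) = ‖z‖ * ‖z‖ ^ (D - 2) := by
        rw [← pow_succ']; congr 1; omega
      rw [hpw]
      rw [div_le_iff₀ (by positivity)] at hz2
      have : 0 ≤ ‖z‖ ^ (D - 2) := by positivity
      nlinarith
    linarith
  constructor
  · calc (e * D * ‖α‖ / 4) * ‖z‖ ^ (D - 1)
        = e * (D * ‖α‖ / 2 * ‖z‖ ^ (D - 1)) - (e * D * ‖α‖ / 4) * ‖z‖ ^ (D - 1) := by ring
      _ ≤ e * ‖p.derivative.eval z‖ - 1 := by
          have h4 : 1 ≤ (e * D * ‖α‖ / 4) * ‖z‖ ^ (D - 1) := by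
            rw [div_le_iff₀ (by positivity)] at hz3
            nlinarith
          nlinarith
      _ ≤ ‖1 - (e : ℂ) * p.derivative.eval z‖ := by
          have := norm_sub_norm_le ((e : ℂ) * p.derivative.eval z) 1
          rw [norm_mul, Complex.norm_natCast, norm_one, norm_sub_rev] at this
          linarith
  · rw [div_le_iff₀ (by positivity)] at hz3
    nlinarith

/-- **The linearisation error is `O(1/‖z₀‖)`**: for `deg p = D ≥ 3`, `e ≥ 1` there is `K` with
`‖e (p(z₀ + λt) - p(z₀) - p'(z₀) λ t)‖ ≤ K/‖z₀‖` whenever `‖z₀‖ ≥ 1`, `‖t‖ ≤ 1` and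
`‖λ‖ (eD|lc p|/4) ‖z₀‖^{D-1} ≤ 1 ≤ (eD|lc p|/4)‖z₀‖^{D-1}` (so `‖λ‖ = O(‖z₀‖^{1-D})`):
the Taylor remainder is `O(‖z₀‖^{D-2} ‖λ‖²) = O(‖z₀‖^{-D})`. [folklore] -/
theorem exists_linearisation_bound (p : Polynomial ℂ) (hD : 3 ≤ p.natDegree) {e : ℕ} (he : 0 < e) :
    ∃ K : ℝ, 0 ≤ K ∧ ∀ z₀ l t : ℂ, 1 ≤ ‖z₀‖ → ‖t‖ ≤ 1 →
      ‖l‖ * ((e * p.natDegree * ‖p.leadingCoeff‖ / 4) * ‖z₀‖ ^ (p.natDegree - 1)) ≤ 1 →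
      1 ≤ (e * p.natDegree * ‖p.leadingCoeff‖ / 4) * ‖z₀‖ ^ (p.natDegree - 1) →
      ‖(e : ℂ) * (p.eval (z₀ + l * t) - p.eval z₀ - p.derivative.eval z₀ * (l * t))‖ ≤ K / ‖z₀‖ := by
  set D : ℕ := p.natDegree with hDdef
  set α : ℂ := p.leadingCoeff with hα
  have hp0 : p ≠ 0 := by rintro rfl; simp [hDdef] at hD
  have hα0 : α ≠ 0 := Polynomial.leadingCoeff_ne_zero.2 hp0
  have hαpos : 0 < ‖α‖ := norm_pos_iff.2 hα0
  have hepos : (0 : ℝ) < e := by exact_mod_cast he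
  have hDpos : (0 : ℝ) < D := by exact_mod_cast (show 0 < D by omega)
  set B : ℝ := coeffNormSum p.derivative with hB
  have hB0 : 0 ≤ B := coeffNormSum_nonneg _
  set c₀ : ℝ := e * D * ‖α‖ / 4 with hc₀
  have hc₀pos : 0 < c₀ := by positivity
  refine ⟨e * (B * ((D - 2 : ℕ) + 1) * 2 ^ (D - 2)) / c₀ ^ 2, by positivity, fun z₀ l t hz1 ht hl hX => ?_⟩
  have hz0 : 0 < ‖z₀‖ := by linarith
  set X : ℝ := c₀ * ‖z₀‖ ^ (D - 1) with hX'
  have hl1 : ‖l‖ ≤ 1 := by nlinarith [norm_nonneg l]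
  have hs : ‖l * t‖ ≤ ‖l‖ := by
    rw [norm_mul]; exact mul_le_of_le_one_right (norm_nonneg _) ht
  have hM : ‖z₀‖ + ‖l * t‖ ≤ ‖z₀‖ + 1 := by linarith
  have hT := norm_eval_add_sub_sub_le p (M := ‖z₀‖ + 1) (by linarith) hM
  rw [norm_mul, Complex.norm_natCast]
  -- `(‖z₀‖ + 1)^{D-2} ≤ 2^{D-2} ‖z₀‖^{D-2}` and `‖l t‖² ≤ ‖l‖² ≤ 1/X²`, `X² ≥ c₀² ‖z₀‖^{D-2} ‖z₀‖^{D} `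
  have h1 : (‖z₀‖ + 1) ^ (D - 2) ≤ 2 ^ (D - 2) * ‖z₀‖ ^ (D - 2) := by
    rw [← mul_pow]; exact pow_le_pow_left₀ (by positivity) (by linarith) _
  have h2 : ‖l * t‖ * ‖l * t‖ ≤ ‖l‖ ^ 2 := by
    rw [sq]; exact mul_le_mul hs hs (norm_nonneg _) (norm_nonneg _)
  have h3 : ‖l‖ ^ 2 * X ^ 2 ≤ 1 := by
    rw [← mul_pow]; exact pow_le_one₀ (by positivity) hl
  have hXsq : X ^ 2 = c₀ ^ 2 * (‖z₀‖ ^ (D - 2) * ‖z₀‖ ^ D) := by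
    rw [hX', mul_pow, ← pow_mul, ← pow_add]; congr 2; omega
  have hzD : ‖z₀‖ ≤ ‖z₀‖ ^ D := le_self_pow₀ hz1 (by omega)
  -- combine
  have hrem : ‖p.eval (z₀ + l * t) - p.eval z₀ - p.derivative.eval z₀ * (l * t)‖ ≤
      B * ((D - 2 : ℕ) + 1) * 2 ^ (D - 2) * (‖z₀‖ ^ (D - 2) * ‖l‖ ^ 2) := by
    refine hT.trans ?_
    have : coeffNormSum p.derivative * ((D - 2 : ℕ) + 1) * (‖z₀‖ + 1) ^ (D - 2) * ‖l * t‖ * ‖l * t‖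
        = B * ((D - 2 : ℕ) + 1) * ((‖z₀‖ + 1) ^ (D - 2) * (‖l * t‖ * ‖l * t‖)) := by rw [hB]; ring
    rw [this]
    have hB1 : 0 ≤ B * ((D - 2 : ℕ) + 1) := by positivity
    calc B * ((D - 2 : ℕ) + 1) * ((‖z₀‖ + 1) ^ (D - 2) * (‖l * t‖ * ‖l * t‖))
        ≤ B * ((D - 2 : ℕ) + 1) * ((2 ^ (D - 2) * ‖z₀‖ ^ (D - 2)) * ‖l‖ ^ 2) :=
          mul_le_mul_of_nonneg_left (mul_le_mul h1 h2 (by positivity) (by positivity)) hB1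
      _ = B * ((D - 2 : ℕ) + 1) * 2 ^ (D - 2) * (‖z₀‖ ^ (D - 2) * ‖l‖ ^ 2) := by ring
  have hkey : ‖z₀‖ ^ (D - 2) * ‖l‖ ^ 2 ≤ 1 / (c₀ ^ 2 * ‖z₀‖) := by
    rw [le_div_iff₀ (by positivity)]
    calc ‖z₀‖ ^ (D - 2) * ‖l‖ ^ 2 * (c₀ ^ 2 * ‖z₀‖)
        ≤ ‖z₀‖ ^ (D - 2) * ‖l‖ ^ 2 * (c₀ ^ 2 * ‖z₀‖ ^ D) := by gcongr
      _ = ‖l‖ ^ 2 * X ^ 2 := by rw [hXsq]; ring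
      _ ≤ 1 := h3
  calc (e : ℝ) * ‖p.eval (z₀ + l * t) - p.eval z₀ - p.derivative.eval z₀ * (l * t)‖
      ≤ e * (B * ((D - 2 : ℕ) + 1) * 2 ^ (D - 2) * (1 / (c₀ ^ 2 * ‖z₀‖))) := by
        refine mul_le_mul_of_nonneg_left (hrem.trans ?_) hepos.le
        exact mul_le_mul_of_nonneg_left hkey (by positivity)
    _ = e * (B * ((D - 2 : ℕ) + 1) * 2 ^ (D - 2)) / c₀ ^ 2 / ‖z₀‖ := by
        field_simp

end Summit.Schanuel.Schanuel.Theorems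

end
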